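import Summits.HubbardSuperconductivity.HubbardSuperconductivity.Theorems.WidthHaldaneDefs

/-!
# The ADDITIVE width induction of route `SeamInduction`, as citable theorems:
# uniform constants per width + conditional additive one-seam locality ⟹ `WidthUniformThermodynamics`

Route `SeamInduction` derives its target `WidthUniformThermodynamics` (stmt-HubbardSuperconductivity-16312)
from two cruxes by a width induction. The cruxes AS TYPED — `PerWidthThermodynamics` (stmt-18510,
constants free to degrade with the width) and `SeamGluingLocality` (stmt-18509, MULTIPLICATIVE,
UNGUARDED, `(U,δ)`-universal one-seam locality) — carry the verdicts `open-problem` resp. `misstated`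
(item notes of 2026-08-17; `Theorems/SeamGluingLocality/Negative/*`), and the crux strategist's
RESTATE PACKAGE (`Cruxes/SeamGluingLocality/RESTATE-PACKAGE.md`, kernel-checked in the workfile
`Cruxes/SeamGluingLocality/Lines/seam_flow.lean`, Part A) proposes instead

* `UniformConstantsPerWidth` (18510′): at one `(U, δ)` there are UNIFORM constants `d > 0`, `k` such
  that every wide even width `M ≥ m₁` has, beyond ITS OWN length threshold `L₁(M)`, twist stiffness
  `≥ d` and inverse pair compressibility in `[d, k]` (a family of quasi-1D statements);
* `CondAdditiveLocality` (18509′): for all `(U, δ)` and floor data `(d, k)` there are `C ≥ 0`, `m₀`,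
  `L₂` such that parts FLOORED by `(d, k)` glue with ADDITIVE losses `C/M` on the three comparisons.

Workfiles under `Cruxes/` are not importable by route files or by `Theorems/`. This file lands the
glue of the restated architecture in the tree, abstractly and over the tube names of
`Theorems/WidthHaldaneDefs`, so that after the restate the deciding theorem is a three-liner:

* `uniform_of_uniformConstants_of_condAdditive` — ABSTRACT ADDITIVE WIDTH INDUCTION over two
  arbitrary width-indexed functionals `ρ, κ` (no Hubbard content): uniform constants per width plus
  conditional additive locality AT THE ONE floor datum `(d/2, k + d/2)` give width-uniform bounds
  `d/2 ≤ ρ`, `d/2 ≤ κ ≤ k + d/2` on all even `M₁ ≤ M ≤ L`, `L ≥ L₀` even. Mechanism (the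
  strategist's `key_additive`): strong induction on `M` with the loss budget
  `ℓ(M) = 2C/M₁ − 2C/M ≤ d/2`, base window `[M₁, 2M₁ + 2]` (finitely many widths, `L₀` the max of
  their thresholds), step `M ↦ (2⌊M/4⌋, M − 2⌊M/4⌋)` whose larger part is `≤ 2M/3`, so that
  `ℓ(part) + C/M ≤ ℓ(M)`; `M₁ ≥ 4C/d`. Primed version: locality for all floor data, conclusion
  `∃ d₀ > 0, k₀, M₁, L₀`.
* `uniformThermo_of_uniformConstants_of_condAdditive` — the same over `tubeStiffness` /
  `tubePairCompressibility` / `UniformThermo`, pointwise in `(U, δ)`.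
* `widthUniformThermodynamics_of_uniformConstants_of_condAdditive` (+ the `SeamInduction` copy) — the
  target stmt-16312 from the two restated cruxes; the hypotheses are written over the names and are
  definitionally the let-prefixed Props `SeamFlow.UniformConstantsPerWidth` /
  `SeamFlow.CondAdditiveLocality` of the RESTATE PACKAGE (checked: those terms are accepted by these
  theorems as `fun hA hB => … hA hB`, no rewriting).

The floored MULTIPLICATIVE restatement shape (boundary factors `1 ∓ M₂/M` on floored parts) reduces
to the additive one by Bloch's bound `ρ̃ ≤ 2`: see the companion file
`SeamInductionFlooredGluingWidthInduction.lean`. Reading: nothing here touches the physics of either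
crux (both restated cruxes remain open-problem strength); it certifies in the tree that the restated,
weaker pair still yields stmt-16312. Real arithmetic and bookkeeping only; no definitions, no named
facts. The abstract induction is adapted from the kernel-checked `key_additive` of the crux
strategist's workfile `Cruxes/SeamGluingLocality/Lines/seam_flow.lean` (2026-08-17), re-packaged
pointwise in `(U, δ)`.
-/

noncomputable section

namespace Summit.HubbardSuperconductivity.HubbardSuperconductivity.Theorems.WidthUniformThermodynamics

set_option linter.dupNamespace false -- summit = problem name (single-conjunct summit), D-0017

open scoped BigOperators Classical Matrix
open Summit.HubbardSuperconductivity.HubbardSuperconductivity.Theorems.WidthHaldane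
open Summit.HubbardSuperconductivity.HubbardSuperconductivity.Theses.WidthHaldane
  (WidthUniformThermodynamics)

/-! ### The abstract additive width induction -/

/-- **Abstract additive width induction.** Let `ρ, κ` be real functionals of an even tube
`(L, M, Λ, e)`. Suppose (uniform constants, per-width lengths) there are `d > 0`, `k`, `m₁` such that
every even width `M ≥ m₁` has a threshold `L₁(M)` with `d ≤ ρ`, `d ≤ κ ≤ k` for all even
`L ≥ max(M, L₁(M))` and all labellings, and (conditional additive one-seam locality at the floor
datum `(d/2, k + d/2)`) there are `C ≥ 0`, `m₀`, `L₂` such that for even `L ≥ L₂` and even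
`M', M'' ≥ m₀` with `M' + M'' = M ≤ L`, whenever both parts satisfy `d/2 ≤ ρ`, `d/2 ≤ κ ≤ k + d/2`:
`min(ρ', ρ'') − C/M ≤ ρ_M`, `min(κ', κ'') − C/M ≤ κ_M ≤ max(κ', κ'') + C/M`. Then `d/2 ≤ ρ` and
`0 < κ ≤ k + d/2` (indeed `d/2 ≤ κ`) for ALL even `L ≥ L₀`, all even `M₁ ≤ M ≤ L`, all labellings,
for some `M₁, L₀`. (Strong induction on `M` with loss budget `ℓ(M) = 2C/M₁ − 2C/M`.) [folklore] -/
theorem uniform_of_uniformConstants_of_condAdditive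
    (ρ κ : ∀ (L M : ℕ) [NeZero L] [NeZero M] (Λ : Type) [LinearOrder Λ] [Fintype Λ],
      (Λ ≃ ZMod L × ZMod M) → ℝ)
    {d k : ℝ} (hd : 0 < d) (m₁ : ℕ)
    (hA : ∀ (M : ℕ) [NeZero M], Even M → m₁ ≤ M → ∃ L₁ : ℕ, ∀ (L : ℕ) [NeZero L], Even L → M ≤ L →
      L₁ ≤ L → ∀ (Λ : Type) [LinearOrder Λ] [Fintype Λ] (e : Λ ≃ ZMod L × ZMod M),
        d ≤ ρ L M Λ e ∧ d ≤ κ L M Λ e ∧ κ L M Λ e ≤ k)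
    {C : ℝ} (hC : 0 ≤ C) (m₀ L₂ : ℕ)
    (hB : ∀ (L M' M'' M : ℕ) [NeZero L] [NeZero M'] [NeZero M''] [NeZero M],
      Even L → Even M' → Even M'' → m₀ ≤ M' → m₀ ≤ M'' → M' + M'' = M → M ≤ L → L₂ ≤ L →
        ∀ (Λ' : Type) [LinearOrder Λ'] [Fintype Λ'] (e' : Λ' ≃ ZMod L × ZMod M')
          (Λ'' : Type) [LinearOrder Λ''] [Fintype Λ''] (e'' : Λ'' ≃ ZMod L × ZMod M'')
          (Λ : Type) [LinearOrder Λ] [Fintype Λ] (e : Λ ≃ ZMod L × ZMod M),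
          d / 2 ≤ ρ L M' Λ' e' → d / 2 ≤ ρ L M'' Λ'' e'' → d / 2 ≤ κ L M' Λ' e' →
          d / 2 ≤ κ L M'' Λ'' e'' → κ L M' Λ' e' ≤ k + d / 2 → κ L M'' Λ'' e'' ≤ k + d / 2 →
            min (ρ L M' Λ' e') (ρ L M'' Λ'' e'') - C / M ≤ ρ L M Λ e ∧
            min (κ L M' Λ' e') (κ L M'' Λ'' e'') - C / M ≤ κ L M Λ e ∧
            κ L M Λ e ≤ max (κ L M' Λ' e') (κ L M'' Λ'' e'') + C / M) :
    ∃ M₁ L₀ : ℕ, ∀ (L M : ℕ) [NeZero L] [NeZero M], Even L → Even M → M₁ ≤ M → M ≤ L → L₀ ≤ L →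
      ∀ (Λ : Type) [LinearOrder Λ] [Fintype Λ] (e : Λ ≃ ZMod L × ZMod M),
        d / 2 ≤ ρ L M Λ e ∧ d / 2 ≤ κ L M Λ e ∧ κ L M Λ e ≤ k + d / 2 := by
  -- non-dependent choice of the per-width length thresholds
  have hA' : ∀ M : ℕ, ∃ L₁ : ℕ, Even M → m₁ ≤ M →
      ∀ L : ℕ, Even L → M ≤ L → L₁ ≤ L → ∀ (iL : NeZero L) (iM : NeZero M)
        (Λ : Type) [LinearOrder Λ] [Fintype Λ] (e : Λ ≃ ZMod L × ZMod M),
          d ≤ ρ L M Λ e ∧ d ≤ κ L M Λ e ∧ κ L M Λ e ≤ k := by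
    intro M
    by_cases h : Even M ∧ m₁ ≤ M ∧ 0 < M
    · haveI : NeZero M := ⟨by omega⟩
      obtain ⟨L₁, h1⟩ := hA M h.1 h.2.1
      exact ⟨L₁, fun _ _ L hLe hML hL1 iL iM Λ _ _ e => h1 L hLe hML hL1 Λ e⟩
    · refine ⟨0, fun h1 h2 L _ _ _ iL iM Λ _ _ e => ?_⟩
      exact (h ⟨h1, h2, Nat.pos_of_ne_zero (NeZero.ne M)⟩).elim
  choose L₁ hL₁ using hA'
  -- the base width M₁: even, ≥ m₁, ≥ m₀, ≥ 6 and ≥ 4C/d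
  obtain ⟨M₁, hM₁E, hM₁m₁, hM₁m₀, hM₁6, hM₁C⟩ :
      ∃ M₁ : ℕ, Even M₁ ∧ m₁ ≤ M₁ ∧ m₀ ≤ M₁ ∧ 6 ≤ M₁ ∧ 4 * C / d ≤ M₁ := by
    refine ⟨2 * (m₁ + m₀ + ⌈4 * C / d⌉₊ + 3), even_two_mul _, by omega, by omega, by omega, ?_⟩
    have h1 : 4 * C / d ≤ ⌈4 * C / d⌉₊ := Nat.le_ceil _
    have h2 : ((⌈4 * C / d⌉₊ : ℕ) : ℝ) ≤ (2 * (m₁ + m₀ + ⌈4 * C / d⌉₊ + 3) : ℕ) := by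
      exact_mod_cast (show ⌈4 * C / d⌉₊ ≤ 2 * (m₁ + m₀ + ⌈4 * C / d⌉₊ + 3) by omega)
    exact h1.trans h2
  set I : Finset ℕ := Finset.range (M₁ / 2 + 2) with hI
  set w : ℕ → ℕ := fun i => M₁ + 2 * i with hw
  set L₀ : ℕ := max (I.sup fun i => L₁ (w i)) L₂ with hL₀
  have hwE : ∀ i, Even (w i) := fun i => by
    obtain ⟨r, hr⟩ := hM₁E; exact ⟨r + i, by simp only [hw]; omega⟩
  have hwm : ∀ i, m₁ ≤ w i := fun i => by simp only [hw]; omega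
  have hLb : ∀ i ∈ I, L₁ (w i) ≤ L₀ := fun i hi =>
    (Finset.le_sup (f := fun i => L₁ (w i)) hi).trans (le_max_left _ _)
  have hM₁0 : (0 : ℝ) < M₁ := by exact_mod_cast (show 0 < M₁ by omega)
  -- loss budget
  set ℓ : ℝ → ℝ := fun x => 2 * C / M₁ - 2 * C / x with hℓ
  have hℓ0 : ∀ x : ℝ, (M₁ : ℝ) ≤ x → 0 ≤ ℓ x := by
    intro x hx
    have hx0 : 0 < x := hM₁0.trans_le hx
    simp only [hℓ, sub_nonneg]
    exact div_le_div_of_nonneg_left (by positivity) hM₁0 hx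
  have hℓtop : ∀ x : ℝ, (M₁ : ℝ) ≤ x → ℓ x ≤ d / 2 := by
    intro x hx
    have hx0 : 0 < x := hM₁0.trans_le hx
    have h1 : 2 * C / (M₁ : ℝ) ≤ d / 2 := by
      rw [div_le_iff₀ hM₁0]
      have := hM₁C; rw [div_le_iff₀ hd] at this; linarith
    have h2 : 0 ≤ 2 * C / x := by positivity
    simp only [hℓ]; linarith
  have hℓstep : ∀ x y : ℝ, 0 < x → 3 * x ≤ 2 * y → ℓ x + C / y ≤ ℓ y := by
    intro x y hx hxy
    have hy : 0 < y := by linarith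
    simp only [hℓ]
    have : C / y + 2 * C / y ≤ 2 * C / x := by
      rw [← add_div, div_le_div_iff₀ hy hx]; nlinarith
    linarith
  -- the induction
  have main : ∀ M : ℕ, Even M → M₁ ≤ M → ∀ L : ℕ, Even L → M ≤ L → L₀ ≤ L →
      ∀ (iL : NeZero L) (iM : NeZero M) (Λ : Type) [LinearOrder Λ] [Fintype Λ]
        (e : Λ ≃ ZMod L × ZMod M),
        d - ℓ M ≤ ρ L M Λ e ∧ d - ℓ M ≤ κ L M Λ e ∧ κ L M Λ e ≤ k + ℓ M := by
    intro M
    induction M using Nat.strong_induction_on with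
    | _ M ih =>
      intro hMe hM₁M L hLe hML hL₀L iL iM Λ _ _ e
      have hM₁R : (M₁ : ℝ) ≤ M := by exact_mod_cast hM₁M
      have hM0 : (0 : ℝ) < M := hM₁0.trans_le hM₁R
      have hL₂L : L₂ ≤ L := le_trans (le_max_right _ _) hL₀L
      by_cases hb : M ≤ 2 * M₁ + 2
      · obtain ⟨i, hiI, hwi⟩ : ∃ i ∈ I, w i = M := by
          obtain ⟨r, hr⟩ := hMe; obtain ⟨r₁, hr₁⟩ := hM₁E
          exact ⟨(M - M₁) / 2, by simp only [hI, Finset.mem_range]; omega, by simp only [hw]; omega⟩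
        subst hwi
        obtain ⟨h1, h2, h3⟩ := hL₁ (w i) (hwE i) (hwm i) L hLe hML ((hLb i hiI).trans hL₀L) iL iM Λ e
        have h0 := hℓ0 (w i) hM₁R
        exact ⟨by linarith, by linarith, by linarith⟩
      · replace hb := not_le.mp hb
        set M' : ℕ := 2 * (M / 4) with hM'
        set M'' : ℕ := M - M' with hM''
        obtain ⟨r, hr⟩ := hMe
        haveI iM' : NeZero M' := ⟨by omega⟩
        haveI iM'' : NeZero M'' := ⟨by omega⟩
        have car : ∀ (a b : ℕ) [NeZero a] [NeZero b], ∃ e : Fin (a * b) ≃ ZMod a × ZMod b, True :=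
          fun a b _ _ => ⟨finProdFinEquiv.symm.trans
            (Equiv.prodCongr (ZMod.finEquiv a).toEquiv (ZMod.finEquiv b).toEquiv), trivial⟩
        obtain ⟨e', -⟩ := car L M'
        obtain ⟨e'', -⟩ := car L M''
        have hM'E : Even M' := ⟨M / 4, by omega⟩
        have hM''E : Even M'' := ⟨r - M / 4, by omega⟩
        obtain ⟨l', p', u'⟩ := ih M' (by omega) hM'E (by omega) L hLe (by omega) hL₀L iL iM'
          (Fin (L * M')) e'
        obtain ⟨l'', p'', u''⟩ := ih M'' (by omega) hM''E (by omega) L hLe (by omega) hL₀L iL iM''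
          (Fin (L * M'')) e''
        have hM'R : (M₁ : ℝ) ≤ M' := by exact_mod_cast (show M₁ ≤ M' by omega)
        have hM''R : (M₁ : ℝ) ≤ M'' := by exact_mod_cast (show M₁ ≤ M'' by omega)
        have hM'0 : (0 : ℝ) < M' := hM₁0.trans_le hM'R
        have hM''0 : (0 : ℝ) < M'' := hM₁0.trans_le hM''R
        have h3M' : 3 * (M' : ℝ) ≤ 2 * M := by exact_mod_cast (show 3 * M' ≤ 2 * M by omega)
        have h3M'' : 3 * (M'' : ℝ) ≤ 2 * M := by exact_mod_cast (show 3 * M'' ≤ 2 * M by omega)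
        have t' := hℓtop M' hM'R
        have t'' := hℓtop M'' hM''R
        have z' := hℓ0 M' hM'R
        have z'' := hℓ0 M'' hM''R
        obtain ⟨g1, g2, g3⟩ := hB L M' M'' M hLe hM'E hM''E (by omega) (by omega) (by omega) hML hL₂L
          (Fin (L * M')) e' (Fin (L * M'')) e'' Λ e
          (by linarith) (by linarith) (by linarith) (by linarith) (by linarith) (by linarith)
        have s' := hℓstep M' M hM'0 h3M'
        have s'' := hℓstep M'' M hM''0 h3M''
        refine ⟨?_, ?_, ?_⟩
        · refine le_trans ?_ g1
          rcases le_total (ρ L M' (Fin (L * M')) e') (ρ L M'' (Fin (L * M'')) e'') with h | h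
          · rw [min_eq_left h]; linarith
          · rw [min_eq_right h]; linarith
        · refine le_trans ?_ g2
          rcases le_total (κ L M' (Fin (L * M')) e') (κ L M'' (Fin (L * M'')) e'') with h | h
          · rw [min_eq_left h]; linarith
          · rw [min_eq_right h]; linarith
        · refine g3.trans ?_
          rcases le_total (κ L M' (Fin (L * M')) e') (κ L M'' (Fin (L * M'')) e'') with h | h
          · rw [max_eq_right h]; linarith
          · rw [max_eq_left h]; linarith
  refine ⟨M₁, L₀, ?_⟩
  intro L M iL iM hLe hMe hM₁M hML hL₀L Λ _ _ e
  obtain ⟨h1, h2, h3⟩ := main M hMe hM₁M L hLe hML hL₀L iL iM Λ e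
  have hM₁R : (M₁ : ℝ) ≤ M := by exact_mod_cast hM₁M
  have t := hℓtop M hM₁R
  exact ⟨by linarith, by linarith, by linarith⟩

/-- **Abstract additive width induction, packaged as the route uses it**: uniform constants per
width at `(d, k)` and conditional additive locality FOR ALL floor data `(d', k')` (constants
`C, m₀, L₂` free to depend on them) give `d₀ ≤ ρ`, `0 < κ ≤ k₀` width-uniformly for some `d₀ > 0`,
`k₀`, `M₁`, `L₀`. [folklore] -/
theorem uniform_of_uniformConstants_of_condAdditive'
    (ρ κ : ∀ (L M : ℕ) [NeZero L] [NeZero M] (Λ : Type) [LinearOrder Λ] [Fintype Λ],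
      (Λ ≃ ZMod L × ZMod M) → ℝ)
    {d k : ℝ} (hd : 0 < d) (m₁ : ℕ)
    (hA : ∀ (M : ℕ) [NeZero M], Even M → m₁ ≤ M → ∃ L₁ : ℕ, ∀ (L : ℕ) [NeZero L], Even L → M ≤ L →
      L₁ ≤ L → ∀ (Λ : Type) [LinearOrder Λ] [Fintype Λ] (e : Λ ≃ ZMod L × ZMod M),
        d ≤ ρ L M Λ e ∧ d ≤ κ L M Λ e ∧ κ L M Λ e ≤ k)
    (hB : ∀ d' k' : ℝ, 0 < d' → ∃ C : ℝ, 0 ≤ C ∧ ∃ m₀ L₂ : ℕ,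
      ∀ (L M' M'' M : ℕ) [NeZero L] [NeZero M'] [NeZero M''] [NeZero M],
        Even L → Even M' → Even M'' → m₀ ≤ M' → m₀ ≤ M'' → M' + M'' = M → M ≤ L → L₂ ≤ L →
        ∀ (Λ' : Type) [LinearOrder Λ'] [Fintype Λ'] (e' : Λ' ≃ ZMod L × ZMod M')
          (Λ'' : Type) [LinearOrder Λ''] [Fintype Λ''] (e'' : Λ'' ≃ ZMod L × ZMod M'')
          (Λ : Type) [LinearOrder Λ] [Fintype Λ] (e : Λ ≃ ZMod L × ZMod M),
          d' ≤ ρ L M' Λ' e' → d' ≤ ρ L M'' Λ'' e'' → d' ≤ κ L M' Λ' e' →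
          d' ≤ κ L M'' Λ'' e'' → κ L M' Λ' e' ≤ k' → κ L M'' Λ'' e'' ≤ k' →
            min (ρ L M' Λ' e') (ρ L M'' Λ'' e'') - C / M ≤ ρ L M Λ e ∧
            min (κ L M' Λ' e') (κ L M'' Λ'' e'') - C / M ≤ κ L M Λ e ∧
            κ L M Λ e ≤ max (κ L M' Λ' e') (κ L M'' Λ'' e'') + C / M) :
    ∃ d₀ : ℝ, 0 < d₀ ∧ ∃ k₀ : ℝ, ∃ M₁ L₀ : ℕ, ∀ (L M : ℕ) [NeZero L] [NeZero M], Even L → Even M →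
      M₁ ≤ M → M ≤ L → L₀ ≤ L →
        ∀ (Λ : Type) [LinearOrder Λ] [Fintype Λ] (e : Λ ≃ ZMod L × ZMod M),
          d₀ ≤ ρ L M Λ e ∧ 0 < κ L M Λ e ∧ κ L M Λ e ≤ k₀ := by
  obtain ⟨C, hC, m₀, L₂, hB⟩ := hB (d / 2) (k + d / 2) (by positivity)
  obtain ⟨M₁, L₀, h⟩ := uniform_of_uniformConstants_of_condAdditive ρ κ hd m₁ hA hC m₀ L₂ hB
  refine ⟨d / 2, by positivity, k + d / 2, M₁, L₀, ?_⟩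
  intro L M _ _ hLe hMe hM₁M hML hL₀L Λ _ _ e
  obtain ⟨h1, h2, h3⟩ := h L M hLe hMe hM₁M hML hL₀L Λ e
  exact ⟨h1, by linarith, h3⟩

/-! ### Over the tube names, pointwise in `(U, δ)` -/

/-- **Width-uniform thermodynamics from uniform constants per width plus conditional additive
one-seam locality, at one `(U, δ)`.** If at `(U, δ)` every even width `M ≥ m₁` has, beyond its own
threshold `L₁(M)`, `d ≤ ρ̃_{L,M}` and `d ≤ ẽ″_{L,M} ≤ k` (every labelling; `d > 0`), and at `(U, δ)`
parts floored by any `(d', k')` glue with additive losses `C(d',k')/M`, then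
`UniformThermo U δ d₀ k₀ M₁ L₀` for some `d₀ > 0`, `k₀`, `M₁`, `L₀`. [folklore] -/
theorem uniformThermo_of_uniformConstants_of_condAdditive (U δ : ℝ) {d k : ℝ} (hd : 0 < d) (m₁ : ℕ)
    (hA : ∀ (M : ℕ) [NeZero M], Even M → m₁ ≤ M → ∃ L₁ : ℕ, ∀ (L : ℕ) [NeZero L], Even L → M ≤ L →
      L₁ ≤ L → ∀ (Λ : Type) [LinearOrder Λ] [Fintype Λ] (e : Λ ≃ ZMod L × ZMod M),
        d ≤ tubeStiffness L M Λ e U δ ∧ d ≤ tubePairCompressibility L M Λ e U δ ∧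
          tubePairCompressibility L M Λ e U δ ≤ k)
    (hB : ∀ d' k' : ℝ, 0 < d' → ∃ C : ℝ, 0 ≤ C ∧ ∃ m₀ L₂ : ℕ,
      ∀ (L M' M'' M : ℕ) [NeZero L] [NeZero M'] [NeZero M''] [NeZero M],
        Even L → Even M' → Even M'' → m₀ ≤ M' → m₀ ≤ M'' → M' + M'' = M → M ≤ L → L₂ ≤ L →
        ∀ (Λ' : Type) [LinearOrder Λ'] [Fintype Λ'] (e' : Λ' ≃ ZMod L × ZMod M')
          (Λ'' : Type) [LinearOrder Λ''] [Fintype Λ''] (e'' : Λ'' ≃ ZMod L × ZMod M'')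
          (Λ : Type) [LinearOrder Λ] [Fintype Λ] (e : Λ ≃ ZMod L × ZMod M),
          d' ≤ tubeStiffness L M' Λ' e' U δ → d' ≤ tubeStiffness L M'' Λ'' e'' U δ →
          d' ≤ tubePairCompressibility L M' Λ' e' U δ →
          d' ≤ tubePairCompressibility L M'' Λ'' e'' U δ →
          tubePairCompressibility L M' Λ' e' U δ ≤ k' →
          tubePairCompressibility L M'' Λ'' e'' U δ ≤ k' →
            min (tubeStiffness L M' Λ' e' U δ) (tubeStiffness L M'' Λ'' e'' U δ) - C / M ≤
                tubeStiffness L M Λ e U δ ∧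
            min (tubePairCompressibility L M' Λ' e' U δ) (tubePairCompressibility L M'' Λ'' e'' U δ) -
                  C / M ≤ tubePairCompressibility L M Λ e U δ ∧
            tubePairCompressibility L M Λ e U δ ≤
                max (tubePairCompressibility L M' Λ' e' U δ) (tubePairCompressibility L M'' Λ'' e'' U δ) +
                  C / M) :
    ∃ d₀ : ℝ, 0 < d₀ ∧ ∃ k₀ : ℝ, ∃ M₁ L₀ : ℕ, UniformThermo U δ d₀ k₀ M₁ L₀ :=
  uniform_of_uniformConstants_of_condAdditive' (fun L M _ _ Λ _ _ e => tubeStiffness L M Λ e U δ)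
    (fun L M _ _ Λ _ _ e => tubePairCompressibility L M Λ e U δ) hd m₁ hA hB

/-! ### The target of route `SeamInduction` from the two RESTATED cruxes -/

/-- **`X_of_subs` of the restated route `SeamInduction`**: `UniformConstantsPerWidth` (18510′, here
over the names: some `(U, δ)` with uniform constants `d > 0`, `k` for all even widths `M ≥ m₁`, each
beyond its own `L₁(M)`) and `CondAdditiveLocality` (18509′, over the names: for all `(U, δ)` and floor
data `(d, k)`, additive losses `C/M` on floored parts) imply `WidthUniformThermodynamics`
(stmt-HubbardSuperconductivity-16312, the `WidthHaldane` decl). The two hypotheses are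
`Iff.rfl`-convertible with the let-prefixed Props of `Cruxes/SeamGluingLocality/RESTATE-PACKAGE.md`.
[folklore] -/
theorem widthUniformThermodynamics_of_uniformConstants_of_condAdditive
    (hA : ∃ U : ℝ, 0 < U ∧ ∃ δ ∈ Set.Ioo (0 : ℝ) (3 / 10), ∃ d : ℝ, 0 < d ∧ ∃ k : ℝ, ∃ m₁ : ℕ,
      ∀ (M : ℕ) [NeZero M], Even M → m₁ ≤ M → ∃ L₁ : ℕ, ∀ (L : ℕ) [NeZero L], Even L → M ≤ L →
        L₁ ≤ L → ∀ (Λ : Type) [LinearOrder Λ] [Fintype Λ] (e : Λ ≃ ZMod L × ZMod M),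
          d ≤ tubeStiffness L M Λ e U δ ∧ d ≤ tubePairCompressibility L M Λ e U δ ∧
            tubePairCompressibility L M Λ e U δ ≤ k)
    (hB : ∀ U : ℝ, 0 < U → ∀ δ ∈ Set.Ioo (0 : ℝ) (3 / 10), ∀ d k : ℝ, 0 < d → ∃ C : ℝ, 0 ≤ C ∧
      ∃ m₀ L₂ : ℕ, ∀ (L M' M'' M : ℕ) [NeZero L] [NeZero M'] [NeZero M''] [NeZero M],
        Even L → Even M' → Even M'' → m₀ ≤ M' → m₀ ≤ M'' → M' + M'' = M → M ≤ L → L₂ ≤ L →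
        ∀ (Λ' : Type) [LinearOrder Λ'] [Fintype Λ'] (e' : Λ' ≃ ZMod L × ZMod M')
          (Λ'' : Type) [LinearOrder Λ''] [Fintype Λ''] (e'' : Λ'' ≃ ZMod L × ZMod M'')
          (Λ : Type) [LinearOrder Λ] [Fintype Λ] (e : Λ ≃ ZMod L × ZMod M),
          d ≤ tubeStiffness L M' Λ' e' U δ → d ≤ tubeStiffness L M'' Λ'' e'' U δ →
          d ≤ tubePairCompressibility L M' Λ' e' U δ →
          d ≤ tubePairCompressibility L M'' Λ'' e'' U δ →
          tubePairCompressibility L M' Λ' e' U δ ≤ k →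
          tubePairCompressibility L M'' Λ'' e'' U δ ≤ k →
            min (tubeStiffness L M' Λ' e' U δ) (tubeStiffness L M'' Λ'' e'' U δ) - C / M ≤
                tubeStiffness L M Λ e U δ ∧
            min (tubePairCompressibility L M' Λ' e' U δ) (tubePairCompressibility L M'' Λ'' e'' U δ) -
                  C / M ≤ tubePairCompressibility L M Λ e U δ ∧
            tubePairCompressibility L M Λ e U δ ≤
                max (tubePairCompressibility L M' Λ' e' U δ) (tubePairCompressibility L M'' Λ'' e'' U δ) +
                  C / M) :
    WidthUniformThermodynamics := by
  rw [widthUniformThermodynamics_iff]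
  obtain ⟨U, hU, δ, hδ, d, hd, k, m₁, hA⟩ := hA
  obtain ⟨d₀, hd₀, k₀, M₁, L₀, h⟩ :=
    uniformThermo_of_uniformConstants_of_condAdditive U δ hd m₁ hA (hB U hU δ hδ)
  exact ⟨U, hU, δ, hδ, d₀, hd₀, k₀, M₁, L₀, h⟩

/-- **The target of the restated route `SeamInduction`** (the `SeamInduction` copy of the decl,
definitionally the `WidthHaldane` one): uniform constants per width and conditional additive
one-seam locality (both over the names) give `SeamInduction.WidthUniformThermodynamics`. [folklore] -/
theorem seamInduction_widthUniformThermodynamics_of_uniformConstants_of_condAdditive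
    (hA : ∃ U : ℝ, 0 < U ∧ ∃ δ ∈ Set.Ioo (0 : ℝ) (3 / 10), ∃ d : ℝ, 0 < d ∧ ∃ k : ℝ, ∃ m₁ : ℕ,
      ∀ (M : ℕ) [NeZero M], Even M → m₁ ≤ M → ∃ L₁ : ℕ, ∀ (L : ℕ) [NeZero L], Even L → M ≤ L →
        L₁ ≤ L → ∀ (Λ : Type) [LinearOrder Λ] [Fintype Λ] (e : Λ ≃ ZMod L × ZMod M),
          d ≤ tubeStiffness L M Λ e U δ ∧ d ≤ tubePairCompressibility L M Λ e U δ ∧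
            tubePairCompressibility L M Λ e U δ ≤ k)
    (hB : ∀ U : ℝ, 0 < U → ∀ δ ∈ Set.Ioo (0 : ℝ) (3 / 10), ∀ d k : ℝ, 0 < d → ∃ C : ℝ, 0 ≤ C ∧
      ∃ m₀ L₂ : ℕ, ∀ (L M' M'' M : ℕ) [NeZero L] [NeZero M'] [NeZero M''] [NeZero M],
        Even L → Even M' → Even M'' → m₀ ≤ M' → m₀ ≤ M'' → M' + M'' = M → M ≤ L → L₂ ≤ L →
        ∀ (Λ' : Type) [LinearOrder Λ'] [Fintype Λ'] (e' : Λ' ≃ ZMod L × ZMod M')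
          (Λ'' : Type) [LinearOrder Λ''] [Fintype Λ''] (e'' : Λ'' ≃ ZMod L × ZMod M'')
          (Λ : Type) [LinearOrder Λ] [Fintype Λ] (e : Λ ≃ ZMod L × ZMod M),
          d ≤ tubeStiffness L M' Λ' e' U δ → d ≤ tubeStiffness L M'' Λ'' e'' U δ →
          d ≤ tubePairCompressibility L M' Λ' e' U δ →
          d ≤ tubePairCompressibility L M'' Λ'' e'' U δ →
          tubePairCompressibility L M' Λ' e' U δ ≤ k →
          tubePairCompressibility L M'' Λ'' e'' U δ ≤ k →
            min (tubeStiffness L M' Λ' e' U δ) (tubeStiffness L M'' Λ'' e'' U δ) - C / M ≤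
                tubeStiffness L M Λ e U δ ∧
            min (tubePairCompressibility L M' Λ' e' U δ) (tubePairCompressibility L M'' Λ'' e'' U δ) -
                  C / M ≤ tubePairCompressibility L M Λ e U δ ∧
            tubePairCompressibility L M Λ e U δ ≤
                max (tubePairCompressibility L M' Λ' e' U δ) (tubePairCompressibility L M'' Λ'' e'' U δ) +
                  C / M) :
    Summit.HubbardSuperconductivity.HubbardSuperconductivity.Theses.SeamInduction.WidthUniformThermodynamics :=
  seamInduction_widthUniformThermodynamics_iff.2
    (widthUniformThermodynamics_of_uniformConstants_of_condAdditive hA hB)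

end Summit.HubbardSuperconductivity.HubbardSuperconductivity.Theorems.WidthUniformThermodynamics
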